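/-
Copyright (c) 2026. All rights reserved.
Released under Apache 2.0 license as described in the file LICENSE.
-/
import Literature.MathematicalPhysics.QuantumFieldTheory.Balaban1983to89.B4Lemma22PertVSup

/-!
# B4 p. 581, (2.32) — THE DIVERGENCE-FORM CROSS TERM `D^{η*}_{A₀}F_{1,k}(−A')` OF `V_k` IS FIRST-ORDER SMALL IN
`‖·‖_∞`; LEMMA 2.2 (2.17)_∞ (`n = 0,1`) FOR `G_k(□,Ã)` ON A BOX WITH `V_k` FULLY DISCHARGED

[B4] = T. Bałaban, *(Higgs)₂,₃ quantum fields in a finite volume. III. Regularity and decay of lattice Green's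
functions*, Commun. Math. Phys. **89** (1983) 571–597 (bib key `Balaban1983RegularityDecay`).

## The printed step («» = quotation units, transcript-B4.md ll. 131, 159–166)

p. 579 (2.23): «A = A₀ + A', |A'|, |∂^η_μA'| ≤ c'e^{β−1}»; p. 581: «According to our assumptions Ã is constant in a
neighbourhood of boundary of □, and we choose A₀ equal to this constant. Thus in the decomposition Ã = A₀ + A', the
configuration A' is regular and has a compact support in □.» … «The only trouble is with the term
D^{η*}_{A₀}F_{1,k}(−A'), for which it is not a natural interpretation. Using the formula (2.4) and the fact that A' has
a compact support in □, we have (2.32) (D^{η*}_{A₀}F_{1,k}(−A')f)(x) = (∂^{η*}F_{1,k}(−A'))(x)f(x) +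
Σ_μ F_{1,k}(−A'_{⟨x−ηe_μ,x⟩})(D^{η*}_{A₀,μ}f)(x) = … Thus it is a first order differential operator with small
coefficients. Only here we needed the assumption that Ã is constant in a neighbourhood of ∂□. Now using Lemma 2.2 for
G_k(□,A₀) and the decomposition D^η_Ã = U(A')D^η_{A₀} + F_{1,k}(A'), we have (2.33) … The inequality (2.17) is
proved in the same way.»

## What this file certifies (kernel form; the lineage's typed objects)

The one piece of `V = −vOp` left as a hypothesis by `B4Lemma22PertVSup` — the divergence-form cross term
`C = crossOp c W₀ E` (`E = 1 − U(κA')ᵀ`, `W₀ = U(κA₀)`, `c = boxWt`: `n²/2` per ordered nearest-neighbour pair of the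
box `Π[0,N_μ)`) — is bounded, by the typed version of the summation by parts (2.32):
* §2 `cross_site_eq`: for antisymmetric `A₀`, `(Cu)(z) = Σ_y c(z,y)E(y,z)(W₀(z,y)u(y) − u(z)) +
  Σ_y c(z,y)(E(y,z) − E(z,y))u(z)` (uses `W₀(y,z)ᵀ = W₀(z,y)` and that the abelian flow commutes with `E`): the
  typed `Σ_μ F_{1,k}·(D^{η*}_{A₀,μ}f)` + `(∂^{η*}F_{1,k}(−A'))·f` (the two terms of (2.32));
* §3 `cross_first_le`: the covariant part is `≤ (d+1)ℓθ·Σ_μ‖D^η_{A₀,μ}u‖_∞` under the SIZE bound `|κA'_b| ≤ θ/n`;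
* §4 `sum_box_nbrs` regroups a nearest-neighbour sum over the box by directions; `dir_pair_le` is the summation by
  parts in one direction: the terms of the two `μ`-neighbours of `z` combine into `E`-differences at the PARALLEL
  CONSECUTIVE bonds `(z−e_μ,z), (z,z+e_μ)` in both orientations, each `≤ ℓ|κΔA'||u(z)|` (`pertE_sub_mulVec_le`), so
  `≤ 2ℓθ'/n²·|u(z)|` under the DERIVATIVE bound `|κ(A'(b') − A'(b))| ≤ θ'/n²`; at a `μ`-face the lone term vanishes
  because `A'` vanishes (both orientations) on the `μ`-bonds touching the `μ`-faces — the typed «A' has a compact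
  support in □»; `cross_zeroth_le`: the divergence part is `≤ (d+1)ℓθ'|u(z)|` (the weight `η^{-2}/2` is exactly
  cancelled by the `η²` of the derivative bound);
* §5 `firstOrderSmall_cross : FirstOrderSmall supN C (D^η_{A₀,μ})_μ ((d+1)ℓ(θ+θ'))`;
* §6 `lemma22_17_sup_box` = `B4Lemma22PertVSup.lemma22_17_sup_cross` with `ε_C` instantiated: (2.17)_∞, `n = 0,1`,
  both derivative conventions, for [B4]'s `G_k(□,Ã)` (`B4Lemma22ReduceZero.greenA` at `constBond A₀ + A'`) on a box,
  from: invertibility of `H_k(□,Ã)`; the size, derivative, boundary and contour hypotheses on `A'`; and the explicit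
  smallness condition `(d+2)c((d+1)ℓ(θ+θ') + (d+1)ℓθ + (d+1)ℓ²θ² + a_kℓτ(2+ℓτ)) ≤ 1/2` («for e sufficiently small»).
  With this the chain `B4Thm110ZeroBox*` (zero field) → `B4Lemma22ReduceZero` (constant `A₀`, gauge step, resolvent
  identity) → `B4Lemma22Reduce231` (bootstrap (2.31)–(2.33)) → `B4Lemma22ReduceDeriv` (`D_Ã ↔ D_{A₀}`) →
  `B4Lemma22PertVSup` + this file (`V_k` first-order small) proves the `q = p = ∞`, `n = 0,1` clauses of Lemma 2.2
  (2.17) for `G_k(□,Ã)` on boxes with NO step of [B4] used as a hypothesis.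

## Honest scope

(a) Hypotheses kept: invertibility of `H_k(□,Ã)` (tree `B4Lower18Regular.green_box_l2_bound` supplies it for the
staircase contours under (1.7)); the four typed (2.23)/(1.7)-type conditions on `A'` with free parameters `θ, θ', τ`
(in [B4] all `O(e^βc)`), the boundary condition in the form "`A' = 0` in both orientations on every bond
`(x, x+e_μ)` with `x − e_μ ∉ □` or `x + 2e_μ ∉ □`". (b) Only the sup clauses `n = 0,1` of (2.17) (no Hölder (2.16), no
general `(p,q)`, no `n = 2`); boxes only. (c) Constants explicit and unoptimised. No manuscript step is used as a
hypothesis of a theorem claiming a printed conclusion; 0 cited facts; every theorem is proved from the lineage's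
definitions.

v1.1 (DOCFIX, 2026-08-19, self-audit of every «» unit against transcript-B4.md; XREAD C-pv08g5-10 was ok): four
lineage shorthands for the terms of (2.32) formerly set in «» are now plain text or the verbatim printed terms;
«Ã is constant in a neighbourhood of ∂□» as printed; no Lean statement or proof changed.
-/

namespace Literature.MathematicalPhysics.QuantumFieldTheory.Balaban1983to89.B4Lemma22CrossSup

open Finset Matrix
open Literature.MathematicalPhysics.QuantumFieldTheory.Balaban1983to89.B4GaugeCovariance (fld fld_blockOp_mulVec
  OrthFlow fieldLink boxWt blkWt constBond contourTrans pathEnd sum_boxWt_right)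
open Literature.MathematicalPhysics.QuantumFieldTheory.Balaban1983to89.B4Lower18Regular (e1 pertE crossOp lsum)
open Literature.MathematicalPhysics.QuantumFieldTheory.Balaban1983to89.B4Lemma21Region (siteNorm covDeriv)
open Literature.MathematicalPhysics.QuantumFieldTheory.Balaban1983to89.B4Reflection242 (nbrs mem_nbrs boxDom
  card_nbrs nbrs_comm)
open Literature.MathematicalPhysics.QuantumFieldTheory.Balaban1983to89.B4Lemma22Reduce231
open Literature.MathematicalPhysics.QuantumFieldTheory.Balaban1983to89.B4Lemma22ReduceZero (siteNorm_sum_le Box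
  greenA opA pertV derivA derivA0)
open Literature.MathematicalPhysics.QuantumFieldTheory.Balaban1983to89.B4Lemma22ReduceDeriv (siteNorm_flow_sub_one_le
  siteNorm_flow)
open Literature.MathematicalPhysics.QuantumFieldTheory.Balaban1983to89.B4Lemma22PertVSup

noncomputable section

variable {ι : Type} [Fintype ι] [DecidableEq ι]

/-! ## §1 Differences of flow values and of perturbation matrices -/

/-- `|(U(s) − U(t))v| ≤ ℓ|s − t||v|` for a flow with Lipschitz generator. [folklore] -/
theorem siteNorm_flow_sub_flow_le (F : OrthFlow ι) {ℓ : ℝ} (hℓ : 0 ≤ ℓ)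
    (hLip : ∀ t (v : ι → ℝ), ((F.U t - 1) *ᵥ v) ⬝ᵥ ((F.U t - 1) *ᵥ v) ≤ (ℓ * t) ^ 2 * (v ⬝ᵥ v)) (s t : ℝ)
    (v : ι → ℝ) : siteNorm ((F.U s - F.U t) *ᵥ v) ≤ ℓ * |s - t| * siteNorm v := by
  have h : F.U s - F.U t = (F.U (s - t) - 1) * F.U t := by
    rw [Matrix.sub_mul, Matrix.one_mul, ← F.map_add, sub_add_cancel]
  rw [h, ← mulVec_mulVec]
  refine (siteNorm_flow_sub_one_le F hℓ hLip _ _).trans (le_of_eq ?_)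
  rw [siteNorm_flow]

/-- `|(E(x,y) − E(x',y'))v| ≤ ℓ|κ(A'(x,y) − A'(x',y'))||v|`, `E = 1 − U(κA')ᵀ`: differences of the perturbation matrix
are controlled by DIFFERENCES of `A'` (the term «(∂^η_μF_{1,k}(−A'_μ))(x−ηe_μ)f(x)» of (2.32)).
[cite: Balaban1983RegularityDecay, p. 581 (2.32)] -/
theorem pertE_sub_mulVec_le {X : Type*} (F : OrthFlow ι) {ℓ : ℝ} (hℓ : 0 ≤ ℓ)
    (hLip : ∀ t (v : ι → ℝ), ((F.U t - 1) *ᵥ v) ⬝ᵥ ((F.U t - 1) *ᵥ v) ≤ (ℓ * t) ^ 2 * (v ⬝ᵥ v))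
    (κ : ℝ) (A' : X → X → ℝ) (x y x' y' : X) (v : ι → ℝ) :
    siteNorm ((pertE (fieldLink F κ A') x y - pertE (fieldLink F κ A') x' y') *ᵥ v)
      ≤ ℓ * |κ * (A' x y - A' x' y')| * siteNorm v := by
  have h : pertE (fieldLink F κ A') x y - pertE (fieldLink F κ A') x' y'
      = F.U (-(κ * A' x' y')) - F.U (-(κ * A' x y)) := by
    simp only [pertE, fieldLink, F.transpose_eq, sub_sub_sub_cancel_left]
  rw [h]
  refine (siteNorm_flow_sub_flow_le F hℓ hLip _ _ v).trans (le_of_eq ?_)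
  rw [show -(κ * A' x' y') - -(κ * A' x y) = κ * (A' x y - A' x' y') by ring]

/-! ## §2 The cross term at a site: covariant part + divergence part -/

section Box

variable {d : ℕ}

/-- the box bond weights are symmetric. [folklore] -/
theorem boxWt_symm (n : ℕ) (N : Fin (d + 1) → ℕ) (y z : ↥(boxDom N)) : boxWt n N y z = boxWt n N z y := by
  unfold boxWt
  by_cases h : z.1 ∈ nbrs y.1
  · rw [if_pos h, if_pos (nbrs_comm.1 h)]
  · rw [if_neg h, if_neg fun h' => h (nbrs_comm.1 h')]

/-- **THE CROSS TERM AT A SITE, REGROUPED** (the typed (2.32)): for an antisymmetric background `A₀` (so that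
`W₀(y,z)ᵀ = W₀(z,y)` commutes with `E(y,z)`), `(Cu)(z) = Σ_y c(z,y)E(y,z)(W₀(z,y)u(y) − u(z)) +
Σ_y c(z,y)(E(y,z) − E(z,y))u(z)` — a COVARIANT-DIFFERENCE part (print:
«Σ_μ F_{1,k}(−A'_{⟨x−ηe_μ,x⟩})(D^{η*}_{A₀,μ}f)(x)») plus a DIVERGENCE part (print: «(∂^{η*}F_{1,k}(−A'))(x)f(x)»).
[cite: Balaban1983RegularityDecay, p. 581 (2.32)] -/
theorem cross_site_eq (F : OrthFlow ι) (κ : ℝ) (n : ℕ) (N : Fin (d + 1) → ℕ)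
    (A₀ : ↥(boxDom N) → ↥(boxDom N) → ℝ) (hanti : ∀ x y, A₀ y x = -A₀ x y)
    (A' : ↥(boxDom N) → ↥(boxDom N) → ℝ) (u : ↥(boxDom N) × ι → ℝ) (z : ↥(boxDom N)) :
    fld (crossOp (boxWt n N) (fieldLink F κ A₀) (pertE (fieldLink F κ A')) *ᵥ u) z
      = ∑ y, boxWt n N z y • (pertE (fieldLink F κ A') y z *ᵥ (fieldLink F κ A₀ z y *ᵥ fld u y - fld u z))
        + ∑ y, boxWt n N z y • ((pertE (fieldLink F κ A') y z - pertE (fieldLink F κ A') z y) *ᵥ fld u z) := by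
  rw [fld_crossOp_mulVec]
  have hT : ∀ y, (fieldLink F κ A₀ y z)ᵀ * pertE (fieldLink F κ A') y z
      = pertE (fieldLink F κ A') y z * fieldLink F κ A₀ z y := by
    intro y
    simp only [fieldLink, pertE, F.transpose_eq]
    rw [show A₀ z y = -A₀ y z from hanti y z, mul_neg, Matrix.mul_sub, Matrix.sub_mul, Matrix.mul_one,
      Matrix.one_mul, F.comm]
  have h1 : ∀ y, boxWt n N y z • (((fieldLink F κ A₀ y z)ᵀ * pertE (fieldLink F κ A') y z) *ᵥ fld u y)
      = boxWt n N z y • (pertE (fieldLink F κ A') y z *ᵥ (fieldLink F κ A₀ z y *ᵥ fld u y - fld u z))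
        + boxWt n N z y • (pertE (fieldLink F κ A') y z *ᵥ fld u z) := by
    intro y
    rw [boxWt_symm, hT, ← mulVec_mulVec, ← smul_add, ← mulVec_add, sub_add_cancel]
  simp_rw [h1]
  rw [sum_add_distrib, add_sub_assoc, ← sum_sub_distrib]
  congr 1
  refine sum_congr rfl fun y _ => ?_
  rw [← smul_sub, ← sub_mulVec]

/-! ## §3 The covariant-difference part: first-order small (as for `Cᵀ`) -/

/-- `|Σ_y c(z,y)E(y,z)(W₀(z,y)u(y) − u(z))| ≤ (d+1)ℓθ·Σ_μ‖D^η_{A₀,μ}u‖_∞` under `|κA'_b| ≤ θ/n` on nearest-neighbour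
bonds. [cite: Balaban1983RegularityDecay, p. 581 (2.32)] -/
theorem cross_first_le (F : OrthFlow ι) {ℓ : ℝ} (hℓ : 0 ≤ ℓ)
    (hLip : ∀ t (v : ι → ℝ), ((F.U t - 1) *ᵥ v) ⬝ᵥ ((F.U t - 1) *ᵥ v) ≤ (ℓ * t) ^ 2 * (v ⬝ᵥ v))
    (κ : ℝ) {n : ℕ} (hn : 1 ≤ n) (N : Fin (d + 1) → ℕ) (A₀ : ↥(boxDom N) → ↥(boxDom N) → ℝ)
    (hanti : ∀ x y, A₀ y x = -A₀ x y) {A' : ↥(boxDom N) → ↥(boxDom N) → ℝ} {θ : ℝ} (hθ : 0 ≤ θ)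
    (hA' : ∀ x y, y.1 ∈ nbrs x.1 → |κ * A' x y| ≤ θ / n) (u : ↥(boxDom N) × ι → ℝ) (z : ↥(boxDom N)) :
    siteNorm (∑ y, boxWt n N z y • (pertE (fieldLink F κ A') y z *ᵥ (fieldLink F κ A₀ z y *ᵥ fld u y - fld u z)))
      ≤ ((d : ℝ) + 1) * ℓ * θ * ∑ μ, supN (covDeriv n (boxDom N) (fieldLink F κ A₀) μ *ᵥ u) := by
  have hn0 : (0 : ℝ) < n := by exact_mod_cast hn
  set S := ∑ μ, supN (covDeriv n (boxDom N) (fieldLink F κ A₀) μ *ᵥ u) with hSdef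
  have hS0 : 0 ≤ S := sum_nonneg fun μ _ => supN_nonneg _
  refine (siteNorm_sum_le _ _).trans ?_
  have hterm : ∀ y, siteNorm (boxWt n N z y • (pertE (fieldLink F κ A') y z
      *ᵥ (fieldLink F κ A₀ z y *ᵥ fld u y - fld u z))) ≤ boxWt n N z y * (ℓ * (θ / n) * ((n : ℝ)⁻¹ * S)) := by
    intro y
    rw [siteNorm_smul, abs_of_nonneg (boxWt_nonneg n N z y)]
    by_cases hy : y.1 ∈ nbrs z.1
    · refine mul_le_mul_of_nonneg_left ?_ (boxWt_nonneg n N z y)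
      refine (pertE_mulVec_le F hℓ hLip κ A' y z _).trans ?_
      exact mul_le_mul (mul_le_mul_of_nonneg_left (hA' y z (nbrs_comm.1 hy)) hℓ) (bond_nbr_le F κ hn A₀ hanti u hy)
        (siteNorm_nonneg _) (mul_nonneg hℓ (div_nonneg hθ hn0.le))
    · simp [boxWt, hy]
  refine (sum_le_sum fun y _ => hterm y).trans ?_
  rw [← sum_mul, sum_boxWt_right]
  have h0 : 0 ≤ ℓ * (θ / n) * ((n : ℝ)⁻¹ * S) := by positivity
  calc (n : ℝ) ^ 2 / 2 * (((nbrs z.1).filter fun w => w ∈ boxDom N).card : ℝ) * (ℓ * (θ / n) * ((n : ℝ)⁻¹ * S))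
      ≤ (n : ℝ) ^ 2 / 2 * (2 * ((d : ℝ) + 1)) * (ℓ * (θ / n) * ((n : ℝ)⁻¹ * S)) :=
        mul_le_mul_of_nonneg_right (mul_le_mul_of_nonneg_left (card_nbrs_filter_le N z) (by positivity)) h0
    _ = ((d : ℝ) + 1) * ℓ * θ * S := by field_simp

/-! ## §4 The divergence part: regrouping by directions, summation by parts -/

/-- **REGROUPING A NEAREST-NEIGHBOUR SUM OVER A BOX BY DIRECTIONS**: `Σ_{y ∈ □, |y−z| = 1} g(y) =
Σ_μ ([z+e_μ ∈ □]g(z+e_μ) + [z−e_μ ∈ □]g(z−e_μ))`. [folklore] -/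
theorem sum_box_nbrs {V : Type*} [AddCommMonoid V] (N : Fin (d + 1) → ℕ) (z : ↥(boxDom N))
    (g : ↥(boxDom N) → V) :
    ∑ y : ↥(boxDom N), (if y.1 ∈ nbrs z.1 then g y else 0)
      = ∑ μ, ((if h : z.1 + e1 μ ∈ boxDom N then g ⟨_, h⟩ else 0)
          + (if h : z.1 - e1 μ ∈ boxDom N then g ⟨_, h⟩ else 0)) := by
  classical
  set G : (Fin (d + 1) → ℤ) → V := fun w => if h : w ∈ boxDom N then g ⟨w, h⟩ else 0 with hG
  have hGy : ∀ y : ↥(boxDom N), g y = G y.1 := fun y => by simp only [hG, dif_pos y.2]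
  have h1 : ∑ y : ↥(boxDom N), (if y.1 ∈ nbrs z.1 then g y else 0)
      = ∑ w ∈ boxDom N, (if w ∈ nbrs z.1 then G w else 0) := by
    simp_rw [hGy]
    exact Finset.sum_coe_sort (boxDom N) (fun w => if w ∈ nbrs z.1 then G w else 0)
  rw [h1, Finset.sum_ite_mem]
  have h2 : ∑ w ∈ boxDom N ∩ nbrs z.1, G w = ∑ w ∈ nbrs z.1, G w := by
    refine Finset.sum_subset Finset.inter_subset_right fun w hw hnot => ?_
    have : w ∉ boxDom N := fun hb => hnot (Finset.mem_inter.2 ⟨hb, hw⟩)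
    simp only [hG, dif_neg this]
  rw [h2]
  have hinj₁ : Function.Injective fun i : Fin (d + 1) => z.1 + Pi.single i (1 : ℤ) := by
    intro i j h
    by_contra hij
    have := congrFun h i
    simp [hij] at this
  have hinj₂ : Function.Injective fun i : Fin (d + 1) => z.1 - Pi.single i (1 : ℤ) := by
    intro i j h
    by_contra hij
    have := congrFun h i
    simp [hij] at this
  have hdisj : Disjoint (Finset.univ.image fun i => z.1 + Pi.single i (1 : ℤ))
      (Finset.univ.image fun i => z.1 - Pi.single i (1 : ℤ)) := by
    rw [Finset.disjoint_left]
    intro w hw hw'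
    simp only [Finset.mem_image, Finset.mem_univ, true_and] at hw hw'
    obtain ⟨i, rfl⟩ := hw
    obtain ⟨j, hj⟩ := hw'
    have := congrFun hj i
    by_cases hij : j = i
    · subst hij; simp at this; omega
    · simp [Ne.symm hij] at this
  rw [nbrs, Finset.sum_union hdisj, Finset.sum_image fun x _ y _ h => hinj₁ h,
    Finset.sum_image fun x _ y _ h => hinj₂ h, ← Finset.sum_add_distrib]
  rfl

/-- **THE DIVERGENCE PART IN ONE DIRECTION** (the summation by parts of (2.32), sitewise): at a site `z` and a
direction `μ`, the terms of the two `μ`-neighbours regroup into differences of `E` at PARALLEL CONSECUTIVE bonds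
`(z−e_μ,z), (z,z+e_μ)` (both orientations), each `≤ ℓ·|κΔA'|·|u(z)| ≤ ℓθ'/n²·|u(z)|`; at a `μ`-face the lone term
vanishes because `A'` does on the `μ`-bonds touching the face («A' has a compact support in □»).
[cite: Balaban1983RegularityDecay, p. 581 (2.32)] -/
theorem dir_pair_le (F : OrthFlow ι) {ℓ : ℝ} (hℓ : 0 ≤ ℓ)
    (hLip : ∀ t (v : ι → ℝ), ((F.U t - 1) *ᵥ v) ⬝ᵥ ((F.U t - 1) *ᵥ v) ≤ (ℓ * t) ^ 2 * (v ⬝ᵥ v))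
    (κ : ℝ) (n : ℕ) (N : Fin (d + 1) → ℕ) {A' : ↥(boxDom N) → ↥(boxDom N) → ℝ} {θ' : ℝ} (hθ' : 0 ≤ θ')
    (hder : ∀ (x z y : ↥(boxDom N)) (μ : Fin (d + 1)), z.1 = x.1 + e1 μ → y.1 = z.1 + e1 μ →
      |κ * (A' y z - A' z x)| ≤ θ' / (n : ℝ) ^ 2 ∧ |κ * (A' x z - A' z y)| ≤ θ' / (n : ℝ) ^ 2)
    (hbd : ∀ (x y : ↥(boxDom N)) (μ : Fin (d + 1)), y.1 = x.1 + e1 μ →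
      (x.1 - e1 μ ∉ boxDom N ∨ y.1 + e1 μ ∉ boxDom N) → A' x y = 0 ∧ A' y x = 0)
    (u : ↥(boxDom N) × ι → ℝ) (z : ↥(boxDom N)) (μ : Fin (d + 1)) :
    siteNorm ((if h : z.1 + e1 μ ∈ boxDom N then
        (pertE (fieldLink F κ A') ⟨_, h⟩ z - pertE (fieldLink F κ A') z ⟨_, h⟩) *ᵥ fld u z else 0)
      + (if h : z.1 - e1 μ ∈ boxDom N then
        (pertE (fieldLink F κ A') ⟨_, h⟩ z - pertE (fieldLink F κ A') z ⟨_, h⟩) *ᵥ fld u z else 0))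
      ≤ 2 * (ℓ * (θ' / (n : ℝ) ^ 2)) * siteNorm (fld u z) := by
  have hu := siteNorm_nonneg (fld u z)
  have h0 : 0 ≤ 2 * (ℓ * (θ' / (n : ℝ) ^ 2)) * siteNorm (fld u z) := mul_nonneg (by positivity) hu
  by_cases hp : z.1 + e1 μ ∈ boxDom N <;> by_cases hm : z.1 - e1 μ ∈ boxDom N
  · rw [dif_pos hp, dif_pos hm]
    have hzm : z.1 = (⟨z.1 - e1 μ, hm⟩ : ↥(boxDom N)).1 + e1 μ := (sub_add_cancel _ _).symm
    obtain ⟨h1, h2⟩ := hder ⟨_, hm⟩ z ⟨_, hp⟩ μ hzm rfl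
    have hre : (pertE (fieldLink F κ A') ⟨_, hp⟩ z - pertE (fieldLink F κ A') z ⟨_, hp⟩) *ᵥ fld u z
        + (pertE (fieldLink F κ A') ⟨_, hm⟩ z - pertE (fieldLink F κ A') z ⟨_, hm⟩) *ᵥ fld u z
        = (pertE (fieldLink F κ A') ⟨_, hp⟩ z - pertE (fieldLink F κ A') z ⟨_, hm⟩) *ᵥ fld u z
          + (pertE (fieldLink F κ A') ⟨_, hm⟩ z - pertE (fieldLink F κ A') z ⟨_, hp⟩) *ᵥ fld u z := by
      simp only [sub_mulVec]; abel
    rw [hre]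
    refine (siteNorm_add_le _ _).trans ?_
    have e₁ := pertE_sub_mulVec_le F hℓ hLip κ A' ⟨_, hp⟩ z z ⟨_, hm⟩ (fld u z)
    have e₂ := pertE_sub_mulVec_le F hℓ hLip κ A' ⟨_, hm⟩ z z ⟨_, hp⟩ (fld u z)
    nlinarith [mul_le_mul_of_nonneg_right (mul_le_mul_of_nonneg_left h1 hℓ) hu,
      mul_le_mul_of_nonneg_right (mul_le_mul_of_nonneg_left h2 hℓ) hu]
  · rw [dif_pos hp, dif_neg hm, add_zero]
    obtain ⟨h1, h2⟩ := hbd z ⟨_, hp⟩ μ rfl (Or.inl hm)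
    refine (pertE_sub_mulVec_le F hℓ hLip κ A' ⟨_, hp⟩ z z ⟨_, hp⟩ (fld u z)).trans ?_
    rw [h1, h2, sub_zero, mul_zero, abs_zero, mul_zero, zero_mul]
    exact h0
  · rw [dif_neg hp, dif_pos hm, zero_add]
    have hzm : z.1 = (⟨z.1 - e1 μ, hm⟩ : ↥(boxDom N)).1 + e1 μ := (sub_add_cancel _ _).symm
    obtain ⟨h1, h2⟩ := hbd ⟨_, hm⟩ z μ hzm (Or.inr hp)
    refine (pertE_sub_mulVec_le F hℓ hLip κ A' ⟨_, hm⟩ z z ⟨_, hm⟩ (fld u z)).trans ?_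
    rw [h1, h2, sub_zero, mul_zero, abs_zero, mul_zero, zero_mul]
    exact h0
  · rw [dif_neg hp, dif_neg hm, add_zero, siteNorm_zero]
    exact h0

/-- **THE DIVERGENCE PART IS ZEROTH-ORDER SMALL, SITEWISE**: `|Σ_y c(z,y)(E(y,z) − E(z,y))u(z)| ≤ (d+1)ℓθ'|u(z)|` —
the weight `η^{-2}/2` is cancelled by the DERIVATIVE bound `|κ(A'(b+e_μ) − A'(b))| ≤ θ'/n²` (lattice form of (2.23)
«|∂^η_μA'| ≤ c'e^{β−1}»). [cite: Balaban1983RegularityDecay, p. 581 (2.32); p. 579 (2.23)] -/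
theorem cross_zeroth_le (F : OrthFlow ι) {ℓ : ℝ} (hℓ : 0 ≤ ℓ)
    (hLip : ∀ t (v : ι → ℝ), ((F.U t - 1) *ᵥ v) ⬝ᵥ ((F.U t - 1) *ᵥ v) ≤ (ℓ * t) ^ 2 * (v ⬝ᵥ v))
    (κ : ℝ) {n : ℕ} (hn : 1 ≤ n) (N : Fin (d + 1) → ℕ) {A' : ↥(boxDom N) → ↥(boxDom N) → ℝ} {θ' : ℝ}
    (hθ' : 0 ≤ θ')
    (hder : ∀ (x z y : ↥(boxDom N)) (μ : Fin (d + 1)), z.1 = x.1 + e1 μ → y.1 = z.1 + e1 μ →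
      |κ * (A' y z - A' z x)| ≤ θ' / (n : ℝ) ^ 2 ∧ |κ * (A' x z - A' z y)| ≤ θ' / (n : ℝ) ^ 2)
    (hbd : ∀ (x y : ↥(boxDom N)) (μ : Fin (d + 1)), y.1 = x.1 + e1 μ →
      (x.1 - e1 μ ∉ boxDom N ∨ y.1 + e1 μ ∉ boxDom N) → A' x y = 0 ∧ A' y x = 0)
    (u : ↥(boxDom N) × ι → ℝ) (z : ↥(boxDom N)) :
    siteNorm (∑ y, boxWt n N z y • ((pertE (fieldLink F κ A') y z - pertE (fieldLink F κ A') z y) *ᵥ fld u z))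
      ≤ ((d : ℝ) + 1) * ℓ * θ' * siteNorm (fld u z) := by
  have hn0 : (n : ℝ) ≠ 0 := by
    have : (0 : ℝ) < n := by exact_mod_cast hn
    exact this.ne'
  have hw : ∀ y, boxWt n N z y • ((pertE (fieldLink F κ A') y z - pertE (fieldLink F κ A') z y) *ᵥ fld u z)
      = ((n : ℝ) ^ 2 / 2) • (if y.1 ∈ nbrs z.1 then
          (pertE (fieldLink F κ A') y z - pertE (fieldLink F κ A') z y) *ᵥ fld u z else 0) := by
    intro y
    unfold boxWt
    split_ifs <;> simp
  simp_rw [hw]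
  rw [← Finset.smul_sum, sum_box_nbrs N z
    (fun y => (pertE (fieldLink F κ A') y z - pertE (fieldLink F κ A') z y) *ᵥ fld u z), siteNorm_smul,
    abs_of_nonneg (by positivity)]
  refine (mul_le_mul_of_nonneg_left ((siteNorm_sum_le _ _).trans
    (sum_le_sum fun μ _ => dir_pair_le F hℓ hLip κ n N hθ' hder hbd u z μ)) (by positivity)).trans ?_
  rw [sum_const, card_univ, Fintype.card_fin, nsmul_eq_mul]
  refine le_of_eq ?_
  field_simp
  push_cast
  ring

/-! ## §5 The cross term is first-order small -/

/-- **`|(Cu)(z)| ≤ (d+1)ℓθ·Σ_μ‖D^η_{A₀,μ}u‖_∞ + (d+1)ℓθ'·‖u‖_∞`**. [cite: Balaban1983RegularityDecay, p. 581 (2.32)] -/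
theorem cross_site_le (F : OrthFlow ι) {ℓ : ℝ} (hℓ : 0 ≤ ℓ)
    (hLip : ∀ t (v : ι → ℝ), ((F.U t - 1) *ᵥ v) ⬝ᵥ ((F.U t - 1) *ᵥ v) ≤ (ℓ * t) ^ 2 * (v ⬝ᵥ v))
    (κ : ℝ) {n : ℕ} (hn : 1 ≤ n) (N : Fin (d + 1) → ℕ) (A₀ : ↥(boxDom N) → ↥(boxDom N) → ℝ)
    (hanti : ∀ x y, A₀ y x = -A₀ x y) {A' : ↥(boxDom N) → ↥(boxDom N) → ℝ} {θ θ' : ℝ} (hθ : 0 ≤ θ)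
    (hA' : ∀ x y, y.1 ∈ nbrs x.1 → |κ * A' x y| ≤ θ / n) (hθ' : 0 ≤ θ')
    (hder : ∀ (x z y : ↥(boxDom N)) (μ : Fin (d + 1)), z.1 = x.1 + e1 μ → y.1 = z.1 + e1 μ →
      |κ * (A' y z - A' z x)| ≤ θ' / (n : ℝ) ^ 2 ∧ |κ * (A' x z - A' z y)| ≤ θ' / (n : ℝ) ^ 2)
    (hbd : ∀ (x y : ↥(boxDom N)) (μ : Fin (d + 1)), y.1 = x.1 + e1 μ →
      (x.1 - e1 μ ∉ boxDom N ∨ y.1 + e1 μ ∉ boxDom N) → A' x y = 0 ∧ A' y x = 0)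
    (u : ↥(boxDom N) × ι → ℝ) (z : ↥(boxDom N)) :
    siteNorm (fld (crossOp (boxWt n N) (fieldLink F κ A₀) (pertE (fieldLink F κ A')) *ᵥ u) z)
      ≤ ((d : ℝ) + 1) * ℓ * θ * ∑ μ, supN (covDeriv n (boxDom N) (fieldLink F κ A₀) μ *ᵥ u)
        + ((d : ℝ) + 1) * ℓ * θ' * supN u := by
  rw [cross_site_eq F κ n N A₀ hanti A' u z]
  refine (siteNorm_add_le _ _).trans (add_le_add (cross_first_le F hℓ hLip κ hn N A₀ hanti hθ hA' u z) ?_)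
  exact (cross_zeroth_le F hℓ hLip κ hn N hθ' hder hbd u z).trans
    (mul_le_mul_of_nonneg_left (le_supN u z) (by positivity))

/-- **THE DIVERGENCE-FORM CROSS TERM `C` («D^{η*}_{A₀}F_{1,k}(−A')») IS FIRST-ORDER SMALL IN `‖·‖_∞` RELATIVE TO
`(D^η_{A₀,μ})_μ` WITH CONSTANT `(d+1)ℓ(θ + θ')`**, under: `A₀` antisymmetric; `|κA'_b| ≤ θ/n` on nearest-neighbour
bonds; `|κ(A'(b') − A'(b))| ≤ θ'/n²` for consecutive parallel bonds `b, b'` (both orientations); `A' = 0` on the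
`μ`-bonds touching the `μ`-faces of the box. [cite: Balaban1983RegularityDecay, p. 581 (2.32)] -/
theorem firstOrderSmall_cross (F : OrthFlow ι) {ℓ : ℝ} (hℓ : 0 ≤ ℓ)
    (hLip : ∀ t (v : ι → ℝ), ((F.U t - 1) *ᵥ v) ⬝ᵥ ((F.U t - 1) *ᵥ v) ≤ (ℓ * t) ^ 2 * (v ⬝ᵥ v))
    (κ : ℝ) {n : ℕ} (hn : 1 ≤ n) (N : Fin (d + 1) → ℕ) (A₀ : ↥(boxDom N) → ↥(boxDom N) → ℝ)
    (hanti : ∀ x y, A₀ y x = -A₀ x y) {A' : ↥(boxDom N) → ↥(boxDom N) → ℝ} {θ θ' : ℝ} (hθ : 0 ≤ θ)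
    (hA' : ∀ x y, y.1 ∈ nbrs x.1 → |κ * A' x y| ≤ θ / n) (hθ' : 0 ≤ θ')
    (hder : ∀ (x z y : ↥(boxDom N)) (μ : Fin (d + 1)), z.1 = x.1 + e1 μ → y.1 = z.1 + e1 μ →
      |κ * (A' y z - A' z x)| ≤ θ' / (n : ℝ) ^ 2 ∧ |κ * (A' x z - A' z y)| ≤ θ' / (n : ℝ) ^ 2)
    (hbd : ∀ (x y : ↥(boxDom N)) (μ : Fin (d + 1)), y.1 = x.1 + e1 μ →
      (x.1 - e1 μ ∉ boxDom N ∨ y.1 + e1 μ ∉ boxDom N) → A' x y = 0 ∧ A' y x = 0) :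
    FirstOrderSmall supN (crossOp (boxWt n N) (fieldLink F κ A₀) (pertE (fieldLink F κ A')))
      (covDeriv n (boxDom N) (fieldLink F κ A₀)) (((d : ℝ) + 1) * ℓ * (θ + θ')) := by
  intro u
  have hu := supN_nonneg u
  have hS : 0 ≤ ∑ μ, supN (covDeriv n (boxDom N) (fieldLink F κ A₀) μ *ᵥ u) :=
    sum_nonneg fun μ _ => supN_nonneg _
  have hε : 0 ≤ ((d : ℝ) + 1) * ℓ * (θ + θ') := by positivity
  refine supN_le (mul_nonneg hε (add_nonneg hu hS))
    fun z => (cross_site_le F hℓ hLip κ hn N A₀ hanti hθ hA' hθ' hder hbd u z).trans ?_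
  have h1 : 0 ≤ ((d : ℝ) + 1) * ℓ * θ * supN u := mul_nonneg (by positivity) hu
  have h2 : 0 ≤ ((d : ℝ) + 1) * ℓ * θ' * ∑ μ, supN (covDeriv n (boxDom N) (fieldLink F κ A₀) μ *ᵥ u) :=
    mul_nonneg (by positivity) hS
  nlinarith

/-! ## §6 LEMMA 2.2 (2.17), `q = p = ∞`, `n = 0,1`, FOR `G_k(□,Ã)` ON A BOX — `V_k` FULLY DISCHARGED -/

open Literature.MathematicalPhysics.QuantumFieldTheory.Balaban1983to89.B4Lemma22PertVSup (lemma22_17_sup_cross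
  constBond_antisymm)

/-- **LEMMA 2.2 (2.17)_∞ (`n = 0,1`, both derivative conventions) FOR [B4]'s `G_k(□,Ã)`, `Ã = A₀ + A'`, ON A FINE BOX,
WITH THE PERTURBATION `V_k` FULLY DISCHARGED FROM (2.23)-TYPE HYPOTHESES**: there is `c > 0` (uniform on the window
`a ∈ [amin, aplus]`, `m² ∈ [0, m2plus]`, all `k ≥ 1`, all boxes `Π[0,(ℓ+1)^kM_μ)`, all contour systems ending at the
averaged point, all constant `A₀`) such that IF `H_k(□,Ã)` is invertible, `|κA'_b| ≤ θ/n` on nearest-neighbour bonds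
(size), `|κ(A'(b') − A'(b))| ≤ θ'/n²` on consecutive parallel bonds (derivative), `A' = 0` on the `μ`-bonds touching the
`μ`-faces («Ã is constant in a neighbourhood of ∂□»), `|κA'(Γ_{y,x})| ≤ τ` along the block contours, and
`(d+2)c((d+1)ℓ(θ+θ') + (d+1)ℓθ + (d+1)ℓ²θ² + a_kℓτ(2+ℓτ)) ≤ 1/2` («for e sufficiently small»), THEN for every `Φ`:
`‖GΦ‖_∞ + Σ_μ‖D^η_{A₀,μ}GΦ‖_∞ ≤ 2(d+2)c‖Φ‖_∞` and `‖D^η_{Ã,μ}GΦ‖_∞ ≤ (1+ℓθ)·2(d+2)c‖Φ‖_∞`, `G = G_k(□,Ã)`.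
[cite: Balaban1983RegularityDecay, Lemma 2.2 (2.17) p. 578; proof pp. 579–582 (2.23)–(2.25), (2.31)–(2.33)] -/
theorem lemma22_17_sup_box (F : OrthFlow ι) {ℓ₁ : ℝ} (hℓ₁ : 0 ≤ ℓ₁)
    (hLip : ∀ t (v : ι → ℝ), ((F.U t - 1) *ᵥ v) ⬝ᵥ ((F.U t - 1) *ᵥ v) ≤ (ℓ₁ * t) ^ 2 * (v ⬝ᵥ v))
    (κ : ℝ) (d ℓ : ℕ) (hℓ : 1 ≤ ℓ) (amin aplus m2plus : ℝ) (ha : 0 < amin) :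
    ∃ c : ℝ, 0 < c ∧ ∀ (k : ℕ), 1 ≤ k → ∀ (a m2 : ℝ), amin ≤ a → a ≤ aplus → 0 ≤ m2 → m2 ≤ m2plus →
      ∀ (M : Fin (d + 1) → ℕ), (∀ i, 1 ≤ M i) →
      ∀ (emb : ↥(boxDom M) → ↥(Box d ℓ k M)) (Γ : ↥(boxDom M) → ↥(Box d ℓ k M) → List ↥(Box d ℓ k M)),
        (∀ y x, blkWt ((ℓ + 1) ^ k) M (fun i => (ℓ + 1) ^ k * M i) y x ≠ 0 → pathEnd (emb y) (Γ y x) = x) →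
      ∀ (A₀ : Fin (d + 1) → ℝ) (A' : ↥(Box d ℓ k M) → ↥(Box d ℓ k M) → ℝ) (θ θ' τ : ℝ),
        IsUnit (opA d F κ ℓ k a m2 M emb Γ (constBond A₀ Subtype.val + A')).det →
        0 ≤ θ → (∀ x y : ↥(Box d ℓ k M), y.1 ∈ nbrs x.1 → |κ * A' x y| ≤ θ / ((ℓ + 1) ^ k : ℕ)) →
        0 ≤ θ' → (∀ (x z y : ↥(Box d ℓ k M)) (μ : Fin (d + 1)), z.1 = x.1 + e1 μ → y.1 = z.1 + e1 μ →
          |κ * (A' y z - A' z x)| ≤ θ' / (((ℓ + 1) ^ k : ℕ) : ℝ) ^ 2 ∧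
          |κ * (A' x z - A' z y)| ≤ θ' / (((ℓ + 1) ^ k : ℕ) : ℝ) ^ 2) →
        (∀ (x y : ↥(Box d ℓ k M)) (μ : Fin (d + 1)), y.1 = x.1 + e1 μ →
          (x.1 - e1 μ ∉ Box d ℓ k M ∨ y.1 + e1 μ ∉ Box d ℓ k M) → A' x y = 0 ∧ A' y x = 0) →
        0 ≤ τ → (∀ y x, blkWt ((ℓ + 1) ^ k) M (fun i => (ℓ + 1) ^ k * M i) y x ≠ 0 →
          |κ * lsum A' (emb y) (Γ y x)| ≤ τ) →
        ((d : ℝ) + 2) * c * (((d : ℝ) + 1) * ℓ₁ * (θ + θ') + ((d : ℝ) + 1) * ℓ₁ * θ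
          + ((d : ℝ) + 1) * ℓ₁ ^ 2 * θ ^ 2 + B1.aSeq a ((ℓ : ℝ) + 1) k * (ℓ₁ * τ * (2 + ℓ₁ * τ))) ≤ 1 / 2 →
        ∀ Φ : ↥(Box d ℓ k M) × ι → ℝ,
          supN (greenA d F κ ℓ k a m2 M emb Γ (constBond A₀ Subtype.val + A') *ᵥ Φ)
              + ∑ μ, supN (derivA0 d F κ ℓ k M A₀ μ
                  *ᵥ (greenA d F κ ℓ k a m2 M emb Γ (constBond A₀ Subtype.val + A') *ᵥ Φ))
              ≤ 2 * (((d : ℝ) + 2) * c) * supN Φ ∧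
          ∀ μ : Fin (d + 1),
            supN (derivA d F κ ℓ k M (constBond A₀ Subtype.val + A') μ
                *ᵥ (greenA d F κ ℓ k a m2 M emb Γ (constBond A₀ Subtype.val + A') *ᵥ Φ))
              ≤ (1 + ℓ₁ * θ) * (2 * (((d : ℝ) + 2) * c)) * supN Φ := by
  obtain ⟨c, hc, h⟩ := lemma22_17_sup_cross F hℓ₁ hLip κ d ℓ hℓ amin aplus m2plus ha
  refine ⟨c, hc, ?_⟩
  intro k hk a m2 e1' e2 e3 e4 M hM emb Γ hend A₀ A' θ θ' τ hunit hθ hA' hθ' hder hbd hτ0 hτ hsm Φ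
  have hn : 1 ≤ (ℓ + 1) ^ k := Nat.one_le_pow _ _ (Nat.succ_pos ℓ)
  have hC := firstOrderSmall_cross F hℓ₁ hLip κ hn (fun i => (ℓ + 1) ^ k * M i) (constBond A₀ Subtype.val)
    (constBond_antisymm A₀ Subtype.val) hθ hA' hθ' hder hbd
  exact h k hk a m2 e1' e2 e3 e4 M hM emb Γ hend A₀ A' _ θ τ hunit hθ hA' hτ0 hτ hC hsm Φ

end Box

end

end Literature.MathematicalPhysics.QuantumFieldTheory.Balaban1983to89.B4Lemma22CrossSup
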